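import Literature.NumberTheory.Transcendental.NumCondExponents
import HarnessLib

/-!
# The parameter family of the torsion case of Baker's method on `M_κ`

Topic: `Literature/NumberTheory/Transcendental`. Plan item W4 (closing, torsion case, part 5b)
of the unit `provefact-Literature.NumberTheory.Transcendental.H-b596640137`. The parameters of
the torsion-case engine (`NewPointsTorsion.engine₃`) along a family indexed by `σ → ∞`:
with `a, b` exponents, `ℓ` the ratio of Philippon's range `S = ℓσ^n` to `σ^n`, `sp` the spacing
(the division index `ℓ` of Baker–Wüstholz, p. 117) and `P₀` the number of Siegel rows (the order
of the torsion point), we take, as in `ParameterFamily.lean`, `S₀ + 1 = σ^n` extrapolation zeros,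
`T = 4nσ^{an}`, `T″ = 2σ^{an} - 1`, but the CHEAP degree `D' = 2(4n)^{dd}·P₀·σ^{a·dd}` tuned to
`P₀·T^{dd} < (D'+1)^n` (the Siegel count of the torsion case does not grow with `σ`), and the
radius `R = σ^b·2(nS + sp·S₀)`. PROVED: the elementary clauses (`siegel_feasible`, `two_p_le_q`,
`R_bounds`, …), the comparison with the family `fam = ⟨a, b, ℓ + sp⟩` of `ParameterFamily.lean`
(`D' ≤ fam.D'` once `σ ≥ P₀`, `S ≤ fam.S`, `R ≤ fam.R'`) used to recycle the exponent inequality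
of `NumCondExponents.lean`, and the **zero-estimate numerics of the torsion case**
(`TFamily.numerics`): for `σ` and the spacing `sp` beyond `c·κ₃^n·n!` (`κ₃ = n·2(4n)^{dd}P₀`),
`c·D^n < binom(T″+e, e)·sp·D^m` whenever `dd(n-m) ≤ en`, and `c·D^n < binom(T″+e, e)·D^m` when
the index inequality is strict — the orbit factor is now the CONSTANT `sp` (the orbit of the
division point has at least `sp` elements) instead of `S + 1`, paid for by the cheap `D'`.

## References

* A. Baker, G. Wüstholz, *Logarithmic Forms and Diophantine Geometry*, CUP 2007, §6.8 (pp. 117, 119: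
  "`ℓS'T^d ≫ D^n`").
-/

noncomputable section

open Finset
open scoped PeriodPair

namespace Literature.NumberTheory.Transcendental

namespace GaGmE

namespace Std

namespace BakerData

/-! ### The family -/

/-- The parameter family of the torsion case, indexed by `σ`: exponents `a, b`, ratio `ℓ`,
spacing `sp` (division index) and number of Siegel rows `P₀`. [cite: BakerWustholz2007, §6.8 (pp. 117, 119)] -/
structure TFamily where
  /-- exponent of `T = 4n σ^{an}` -/
  a : ℕ
  /-- exponent of the radius ratio `ρ = σ^b` -/
  b : ℕ
  /-- ratio `S/σ^n = ℓ` of Philippon's range -/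
  ℓ : ℕ
  /-- `ℓ ≥ 1` -/
  hℓ : 1 ≤ ℓ
  /-- the spacing (division index) -/
  sp : ℕ
  /-- `sp ≥ 1` -/
  hsp : 1 ≤ sp
  /-- the number of Siegel rows (order of the torsion point) -/
  P₀ : ℕ
  /-- `P₀ ≥ 1` -/
  hP₀ : 1 ≤ P₀

namespace TFamily

variable (F : TFamily) (n dd : ℕ)

/-- The comparison family of `ParameterFamily.lean`, with ratio `ℓ + sp`. [folklore] -/
def fam : Family := ⟨F.a, F.b, F.ℓ + F.sp, le_add_right F.hℓ⟩

/-- `T = 4n σ^{an}` (that of `fam`). [folklore] -/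
abbrev T (σ : ℕ) : ℕ := F.fam.T n σ
/-- `T″ = 2σ^{an} - 1` (that of `fam`). [folklore] -/
abbrev T₂ (σ : ℕ) : ℕ := F.fam.T₂ n σ
/-- `T' = nT″ + 1` (that of `fam`). [folklore] -/
abbrev T' (σ : ℕ) : ℕ := F.fam.T' n σ
/-- The cheap degree `D' = 2 (4n)^{dd} P₀ σ^{a dd}`. [folklore] -/
def D' (σ : ℕ) : ℕ := 2 * (4 * n) ^ dd * F.P₀ * σ ^ (F.a * dd)
/-- `S = ℓ σ^n`. [folklore] -/
def S (σ : ℕ) : ℕ := F.ℓ * σ ^ n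
/-- `S₁ = n S`. [folklore] -/
def S₁ (σ : ℕ) : ℕ := n * F.S n σ
/-- `S_rows = P₀ - 1`. [folklore] -/
def Srows : ℕ := F.P₀ - 1
/-- `R = σ^b · 2(S₁ + sp·S₀)`. [folklore] -/
def R (σ : ℕ) : ℝ := (σ : ℝ) ^ F.b * (2 * ((F.S₁ n σ : ℝ) + F.sp * Family.S₀ n σ))

/-! ### The elementary clauses -/

/-- `S_rows + 1 = P₀`. [folklore] -/
theorem Srows_add_one : F.Srows + 1 = F.P₀ := by unfold Srows; have := F.hP₀; omega

/-- `D' ≥ 1` for `n, σ ≥ 1`. [folklore] -/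
theorem one_le_D' (hn : 1 ≤ n) {σ : ℕ} (hσ : 1 ≤ σ) : 1 ≤ F.D' n dd σ := by
  unfold D'
  have := Nat.one_le_pow (F.a * dd) σ hσ
  have : 1 ≤ (4 * n) ^ dd := Nat.one_le_pow _ _ (by omega)
  have := F.hP₀
  calc 1 ≤ 2 * 1 * 1 * 1 := by norm_num
    _ ≤ 2 * (4 * n) ^ dd * F.P₀ * σ ^ (F.a * dd) := by gcongr

/-- `S ≥ 1` for `σ ≥ 1`. [folklore] -/
theorem one_le_S {σ : ℕ} (hσ : 1 ≤ σ) : 1 ≤ F.S n σ := by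
  unfold S; exact Nat.one_le_iff_ne_zero.mpr (Nat.mul_ne_zero (by have := F.hℓ; omega) (by positivity))

/-- The key count: `P₀ (4n)^{dd} ≤ 2^n ((4n)^{dd})^n P₀^n` halved, i.e.
`2 · P₀ · T^{dd} ≤ (D')^n`. [folklore] -/
theorem two_mul_rows_le {σ : ℕ} (hn : 1 ≤ n) :
    2 * (F.P₀ * F.T n σ ^ dd) ≤ F.D' n dd σ ^ n := by
  unfold T Family.T D'
  show 2 * (F.P₀ * (4 * n * σ ^ (F.fam.a * n)) ^ dd) ≤ (2 * (4 * n) ^ dd * F.P₀ * σ ^ (F.a * dd)) ^ n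
  have ha : F.fam.a = F.a := rfl
  rw [ha]
  have hσeq : (σ ^ (F.a * n)) ^ dd = (σ ^ (F.a * dd)) ^ n := by
    rw [← pow_mul, ← pow_mul]; congr 1; ring
  have hP := F.hP₀
  have h2 : 2 * (F.P₀ * (4 * n) ^ dd) ≤ (2 * (4 * n) ^ dd * F.P₀) ^ n := by
    have hb : 1 ≤ 2 * (4 * n) ^ dd * F.P₀ := by
      have : 1 ≤ (4 * n) ^ dd := Nat.one_le_pow _ _ (by omega)
      calc 1 = 1 * 1 * 1 := by ring
        _ ≤ 2 * (4 * n) ^ dd * F.P₀ := by gcongr; omega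
    calc 2 * (F.P₀ * (4 * n) ^ dd) = (2 * (4 * n) ^ dd * F.P₀) ^ 1 := by ring
      _ ≤ (2 * (4 * n) ^ dd * F.P₀) ^ n := Nat.pow_le_pow_right hb hn
  calc 2 * (F.P₀ * (4 * n * σ ^ (F.a * n)) ^ dd) = 2 * (F.P₀ * (4 * n) ^ dd) * (σ ^ (F.a * n)) ^ dd := by
        rw [mul_pow]; ring
    _ = 2 * (F.P₀ * (4 * n) ^ dd) * (σ ^ (F.a * dd)) ^ n := by rw [hσeq]
    _ ≤ (2 * (4 * n) ^ dd * F.P₀) ^ n * (σ ^ (F.a * dd)) ^ n := Nat.mul_le_mul_right _ h2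
    _ = (2 * (4 * n) ^ dd * F.P₀ * σ ^ (F.a * dd)) ^ n := by rw [← mul_pow]

/-- **Siegel feasibility of the torsion case**: `(S_rows+1) T^{dd} < (D'+1)^n`. [folklore] -/
theorem siegel_feasible (hn : 1 ≤ n) (σ : ℕ) :
    (F.Srows + 1) * F.T n σ ^ dd < (F.D' n dd σ + 1) ^ n := by
  rw [F.Srows_add_one]
  have h := F.two_mul_rows_le n dd (σ := σ) hn
  calc F.P₀ * F.T n σ ^ dd ≤ 2 * (F.P₀ * F.T n σ ^ dd) := Nat.le_mul_of_pos_left _ two_pos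
    _ ≤ F.D' n dd σ ^ n := h
    _ < (F.D' n dd σ + 1) ^ n := Nat.pow_lt_pow_left (Nat.lt_succ_self _) (by omega)

/-- `2p ≤ q`: `2 (S_rows+1) T^{dd} ≤ (D'+1)^n`. [folklore] -/
theorem two_p_le_q (hn : 1 ≤ n) (σ : ℕ) :
    2 * ((F.Srows + 1) * F.T n σ ^ dd) ≤ (F.D' n dd σ + 1) ^ n := by
  rw [F.Srows_add_one]
  exact (F.two_mul_rows_le n dd (σ := σ) hn).trans (Nat.pow_le_pow_left (Nat.le_succ _) n)

/-- `2(S₁ + sp S₀) ≤ R` and `0 < R` for `n, σ ≥ 1`. [folklore] -/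
theorem R_bounds (hn : 1 ≤ n) {σ : ℕ} (hσ : 1 ≤ σ) :
    0 < F.R n σ ∧ 2 * ((F.S₁ n σ : ℝ) + F.sp * Family.S₀ n σ) ≤ F.R n σ := by
  unfold R
  have hσ' : (1 : ℝ) ≤ (σ : ℝ) ^ F.b := one_le_pow₀ (by exact_mod_cast hσ)
  have h1 : 1 ≤ F.S₁ n σ := by
    unfold S₁
    exact Nat.one_le_iff_ne_zero.mpr (Nat.mul_ne_zero (by omega) (by have := F.one_le_S n hσ; omega))
  have h1' : (1 : ℝ) ≤ (F.S₁ n σ : ℝ) := by exact_mod_cast h1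
  have h0 : (0 : ℝ) ≤ (F.sp : ℝ) * (Family.S₀ n σ : ℝ) := by positivity
  have hpos : (0 : ℝ) < 2 * ((F.S₁ n σ : ℝ) + F.sp * Family.S₀ n σ) := by linarith
  constructor
  · positivity
  · calc 2 * ((F.S₁ n σ : ℝ) + F.sp * Family.S₀ n σ) = 1 * (2 * ((F.S₁ n σ : ℝ) + F.sp * Family.S₀ n σ)) := by ring
      _ ≤ (σ : ℝ) ^ F.b * (2 * ((F.S₁ n σ : ℝ) + F.sp * Family.S₀ n σ)) :=
        mul_le_mul_of_nonneg_right hσ' hpos.le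

/-! ### Comparison with the family `fam = ⟨a, b, ℓ + sp⟩` -/

/-- `D' ≤ fam.D'` once `σ ≥ P₀`. [folklore] -/
theorem D'_le_fam {σ : ℕ} (hσP : F.P₀ ≤ σ) : F.D' n dd σ ≤ F.fam.D' n dd σ := by
  unfold D' Family.D'
  show 2 * (4 * n) ^ dd * F.P₀ * σ ^ (F.a * dd) ≤ 2 * (4 * n) ^ dd * σ ^ (1 + F.a * dd)
  rw [pow_add, pow_one]
  calc 2 * (4 * n) ^ dd * F.P₀ * σ ^ (F.a * dd) ≤ 2 * (4 * n) ^ dd * σ * σ ^ (F.a * dd) := by gcongr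
    _ = 2 * (4 * n) ^ dd * (σ * σ ^ (F.a * dd)) := by ring

/-- `n D' ≤ fam.Dn` once `σ ≥ P₀`. [folklore] -/
theorem nD'_le_Dn {σ : ℕ} (hσP : F.P₀ ≤ σ) : n * F.D' n dd σ ≤ F.fam.Dn n dd σ :=
  Nat.mul_le_mul_left n (F.D'_le_fam n dd hσP)

/-- `S ≤ fam.S`. [folklore] -/
theorem S_le_fam (σ : ℕ) : F.S n σ ≤ F.fam.S n σ := by
  unfold S Family.S
  show F.ℓ * σ ^ n ≤ (F.ℓ + F.sp) * σ ^ n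
  exact Nat.mul_le_mul_right _ (Nat.le_add_right _ _)

/-- `S₁ ≤ fam.S₁`. [folklore] -/
theorem S₁_le_fam (σ : ℕ) : F.S₁ n σ ≤ F.fam.S₁ n σ :=
  Nat.mul_le_mul_left n (F.S_le_fam n σ)

/-- `R ≤ fam.R'` for `n, σ ≥ 1`. [folklore] -/
theorem R_le_R' (hn : 1 ≤ n) {σ : ℕ} (hσ : 1 ≤ σ) : F.R n σ ≤ (F.fam.R' n σ : ℝ) := by
  unfold R Family.R'
  show (σ : ℝ) ^ F.b * (2 * ((F.S₁ n σ : ℝ) + F.sp * Family.S₀ n σ)) ≤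
    ((2 * (n * (F.ℓ + F.sp) + 1) * σ ^ (F.b + n) : ℕ) : ℝ)
  have hS₀ : (Family.S₀ n σ : ℝ) + 1 = (σ : ℝ) ^ n := by exact_mod_cast Family.S₀_add_one n hσ
  have hS₁ : (F.S₁ n σ : ℝ) = n * F.ℓ * (σ : ℝ) ^ n := by unfold S₁ S; push_cast; ring
  have hsp0 : (0 : ℝ) ≤ F.sp := Nat.cast_nonneg _
  have hσn : (1 : ℝ) ≤ (σ : ℝ) ^ n := one_le_pow₀ (by exact_mod_cast hσ)
  have hn1 : (1 : ℝ) ≤ n := by exact_mod_cast hn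
  have hsum : (F.S₁ n σ : ℝ) + F.sp * Family.S₀ n σ ≤ ((n : ℝ) * (F.ℓ + F.sp) + 1) * (σ : ℝ) ^ n := by
    rw [hS₁, show (Family.S₀ n σ : ℝ) = (σ : ℝ) ^ n - 1 by linarith]
    have h1 : (F.sp : ℝ) * ((σ : ℝ) ^ n - 1) ≤ F.sp * (σ : ℝ) ^ n := by nlinarith
    have h2 : (F.sp : ℝ) * (σ : ℝ) ^ n ≤ n * (F.sp * (σ : ℝ) ^ n) :=
      le_mul_of_one_le_left (by positivity) hn1
    have h3 : (0 : ℝ) ≤ (σ : ℝ) ^ n := by positivity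
    nlinarith
  have hpos : (0 : ℝ) ≤ (σ : ℝ) ^ F.b := by positivity
  calc (σ : ℝ) ^ F.b * (2 * ((F.S₁ n σ : ℝ) + F.sp * Family.S₀ n σ))
      ≤ (σ : ℝ) ^ F.b * (2 * (((n : ℝ) * (F.ℓ + F.sp) + 1) * (σ : ℝ) ^ n)) := by nlinarith
    _ = ((2 * (n * (F.ℓ + F.sp) + 1) * σ ^ (F.b + n) : ℕ) : ℝ) := by push_cast; ring

/-- `sp · (S_rows) + 1 ≤ S₀ + 1 = σ^n` once `σ ≥ sp · P₀` (`n ≥ 1`). [folklore] -/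
theorem sp_mul_Srows_lt {σ : ℕ} (hn : 1 ≤ n) (hσ : F.sp * F.P₀ ≤ σ) : F.sp * F.Srows + 1 ≤ Family.S₀ n σ + 1 := by
  have hσ1 : 1 ≤ σ := le_trans (Nat.one_le_iff_ne_zero.mpr (Nat.mul_ne_zero (by have := F.hsp; omega)
    (by have := F.hP₀; omega))) hσ
  rw [Family.S₀_add_one n hσ1]
  have h1 : F.sp * F.Srows + 1 ≤ F.sp * F.P₀ := by
    unfold Srows
    have := F.hsp; have := F.hP₀
    calc F.sp * (F.P₀ - 1) + 1 = F.sp * F.P₀ - F.sp + 1 := by rw [Nat.mul_sub, mul_one]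
      _ ≤ F.sp * F.P₀ := by
          have : F.sp ≤ F.sp * F.P₀ := Nat.le_mul_of_pos_right _ (by omega)
          omega
  calc F.sp * F.Srows + 1 ≤ F.sp * F.P₀ := h1
    _ ≤ σ := hσ
    _ = σ ^ 1 := (pow_one σ).symm
    _ ≤ σ ^ n := Nat.pow_le_pow_right hσ1 hn

/-! ### The zero-estimate numerics of the torsion case -/

/-- The exponent bookkeeping of the non-strict numerics: from `dd(n-m) ≤ en`,
`(a·dd)(n - m) ≤ a·n·e`. [folklore] -/
theorem exp_le_A {n dd a e m : ℕ} (hidx : dd * (n - m) ≤ e * n) : (a * dd) * (n - m) ≤ a * n * e := by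
  have : a * (dd * (n - m)) ≤ a * (e * n) := Nat.mul_le_mul_left a hidx
  nlinarith [this]

/-- The exponent bookkeeping of the strict numerics: from `dd(n-m) < en` and `a ≥ 1`,
`(a·dd)(n - m) + 1 ≤ a·n·e`. [folklore] -/
theorem exp_le_B {n dd a e m : ℕ} (ha : 1 ≤ a) (hidx : dd * (n - m) < e * n) :
    (a * dd) * (n - m) + 1 ≤ a * n * e := by
  have h1 : dd * (n - m) + 1 ≤ e * n := hidx
  have : a * (dd * (n - m) + 1) ≤ a * (e * n) := Nat.mul_le_mul_left a h1
  nlinarith [this]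

/-- **The zero-estimate numerics of the torsion case, orders `e ≤ n`.** [folklore] -/
theorem numerics_le (hn : 1 ≤ n) {c : ℝ} (hc : 0 < c) (ha : 1 ≤ F.a)
    (hspc : c * ((n * (2 * (4 * n) ^ dd * F.P₀) : ℕ) : ℝ) ^ n * n.factorial < F.sp) {σ : ℕ} (hσ : 1 ≤ σ)
    (hσK : c * ((n * (2 * (4 * n) ^ dd * F.P₀) : ℕ) : ℝ) ^ n * n.factorial < σ) {e m : ℕ} (hen : e ≤ n)
    (hm : m < n) (hidx : dd * (n - m) ≤ e * n) :
    (c * ((n * F.D' n dd σ : ℕ) : ℝ) ^ n <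
        (Nat.choose (F.T₂ n σ + e) e : ℝ) * (F.sp : ℝ) * ((n * F.D' n dd σ : ℕ) : ℝ) ^ m) ∧
    (dd * (n - m) < e * n →
      c * ((n * F.D' n dd σ : ℕ) : ℝ) ^ n < (Nat.choose (F.T₂ n σ + e) e : ℝ) * ((n * F.D' n dd σ : ℕ) : ℝ) ^ m) := by
  set κ : ℝ := ((n * (2 * (4 * n) ^ dd * F.P₀) : ℕ) : ℝ) with hκ
  have hκ1 : 1 ≤ κ := by
    rw [hκ]
    have hP := F.hP₀
    exact_mod_cast Nat.one_le_iff_ne_zero.mpr (Nat.mul_ne_zero (by omega)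
      (Nat.mul_ne_zero (Nat.mul_ne_zero two_ne_zero (pow_ne_zero _ (by omega))) (by omega)))
  have hσ1 : (1 : ℝ) ≤ σ := by exact_mod_cast hσ
  have hmn : m ≤ n := hm.le
  have hD : ((n * F.D' n dd σ : ℕ) : ℝ) = κ * (σ : ℝ) ^ (F.a * dd) := by
    rw [hκ]; unfold D'; push_cast; ring
  have hσ0 : (0 : ℝ) < σ := by linarith
  have hκ0 : (0 : ℝ) < κ := by linarith
  have hDpos : (0 : ℝ) < ((n * F.D' n dd σ : ℕ) : ℝ) := by rw [hD]; exact mul_pos hκ0 (pow_pos hσ0 _)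
  have hchoose : (σ : ℝ) ^ (F.a * n * e) / e.factorial ≤ (Nat.choose (F.T₂ n σ + e) e : ℝ) := by
    have hM := Nat.pow_le_choose (α := ℝ) e (F.T₂ n σ + e)
    rw [show F.T₂ n σ + e + 1 - e = F.T₂ n σ + 1 by omega] at hM
    refine le_trans (div_le_div_of_nonneg_right ?_ (by positivity)) hM
    push_cast
    rw [pow_mul]
    refine pow_le_pow_left₀ (by positivity) ?_ e
    have : ((σ ^ (F.a * n) : ℕ) : ℝ) ≤ (F.T₂ n σ : ℝ) := by
      have h := F.fam.pow_le_T₂ n hσ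
      exact_mod_cast h
    push_cast at this
    linarith
  have hsp1 : (1 : ℝ) ≤ F.sp := by exact_mod_cast F.hsp
  have hsplit : ((n * F.D' n dd σ : ℕ) : ℝ) ^ n =
      ((n * F.D' n dd σ : ℕ) : ℝ) ^ (n - m) * ((n * F.D' n dd σ : ℕ) : ℝ) ^ m := by
    rw [← pow_add, Nat.sub_add_cancel hmn]
  have hefact : ((e.factorial : ℕ) : ℝ) ≤ n.factorial := by exact_mod_cast Nat.factorial_le hen
  have hefpos : (0 : ℝ) < e.factorial := by exact_mod_cast e.factorial_pos
  -- the constant `c κ^{n-m} e!` is at most `K = c κ^n n!`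
  have hKle : c * κ ^ (n - m) * (e.factorial : ℝ) ≤ c * κ ^ n * n.factorial := by
    have : κ ^ (n - m) ≤ κ ^ n := pow_le_pow_right₀ hκ1 (Nat.sub_le _ _)
    exact mul_le_mul (mul_le_mul_of_nonneg_left this hc.le) hefact hefpos.le (by positivity)
  have hK0 : 0 ≤ c * κ ^ n * (n.factorial : ℝ) := by positivity
  -- both clauses reduce to `c κ^{n-m} e! σ^{(a dd)(n-m)} < X σ^{a n e}`
  have reshape : ∀ {X : ℝ}, 0 < X →
      c * κ ^ (n - m) * (e.factorial : ℝ) * (σ : ℝ) ^ ((F.a * dd) * (n - m)) < X * (σ : ℝ) ^ (F.a * n * e) →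
      c * ((n * F.D' n dd σ : ℕ) : ℝ) ^ n <
        ((σ : ℝ) ^ (F.a * n * e) / e.factorial) * X * ((n * F.D' n dd σ : ℕ) : ℝ) ^ m := by
    intro X hX h
    rw [hsplit, hD, mul_pow, ← pow_mul]
    have h' : c * (κ ^ (n - m) * (σ : ℝ) ^ ((F.a * dd) * (n - m))) <
        (σ : ℝ) ^ (F.a * n * e) / e.factorial * X := by
      rw [div_mul_eq_mul_div, lt_div_iff₀ hefpos]
      calc c * (κ ^ (n - m) * (σ : ℝ) ^ ((F.a * dd) * (n - m))) * e.factorial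
          = c * κ ^ (n - m) * (e.factorial : ℝ) * (σ : ℝ) ^ ((F.a * dd) * (n - m)) := by ring
        _ < X * (σ : ℝ) ^ (F.a * n * e) := h
        _ = (σ : ℝ) ^ (F.a * n * e) * X := by ring
    calc c * ((κ ^ (n - m) * (σ : ℝ) ^ ((F.a * dd) * (n - m))) * (κ * (σ : ℝ) ^ (F.a * dd)) ^ m)
        = (c * (κ ^ (n - m) * (σ : ℝ) ^ ((F.a * dd) * (n - m)))) * (κ * (σ : ℝ) ^ (F.a * dd)) ^ m := by ring
      _ < ((σ : ℝ) ^ (F.a * n * e) / e.factorial * X) * (κ * (σ : ℝ) ^ (F.a * dd)) ^ m :=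
          mul_lt_mul_of_pos_right h' (pow_pos (mul_pos hκ0 (pow_pos hσ0 _)) _)
      _ = _ := by ring
  constructor
  · -- non-strict clause, `X = sp`
    have hexp := exp_le_A (a := F.a) hidx
    have hmain : c * κ ^ (n - m) * (e.factorial : ℝ) * (σ : ℝ) ^ ((F.a * dd) * (n - m)) <
        (F.sp : ℝ) * (σ : ℝ) ^ (F.a * n * e) := by
      by_cases hgap : (F.a * dd) * (n - m) + 1 ≤ F.a * n * e
      · calc c * κ ^ (n - m) * (e.factorial : ℝ) * (σ : ℝ) ^ ((F.a * dd) * (n - m))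
            ≤ (c * κ ^ n * n.factorial) * (σ : ℝ) ^ ((F.a * dd) * (n - m)) :=
              mul_le_mul_of_nonneg_right hKle (by positivity)
          _ < (σ : ℝ) ^ (F.a * n * e) := Family.const_mul_pow_lt_pow hK0 hgap hσK hσ
          _ ≤ (F.sp : ℝ) * (σ : ℝ) ^ (F.a * n * e) := le_mul_of_one_le_left (by positivity) hsp1
      · -- no gap: the exponents agree, and the constants compare by `hspc`
        have heq : (F.a * dd) * (n - m) = F.a * n * e := by omega
        rw [heq]
        have hpow : (0 : ℝ) < (σ : ℝ) ^ (F.a * n * e) := pow_pos hσ0 _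
        have hlt : c * κ ^ (n - m) * (e.factorial : ℝ) < F.sp := lt_of_le_of_lt hKle hspc
        exact mul_lt_mul_of_pos_right hlt hpow
    exact (reshape (by positivity) hmain).trans_le (by
      refine mul_le_mul_of_nonneg_right (mul_le_mul_of_nonneg_right hchoose (by positivity)) (pow_nonneg hDpos.le _))
  · -- strict clause, `X = 1`
    intro hstrict
    have hexp := exp_le_B (a := F.a) ha hstrict
    have hmain : c * κ ^ (n - m) * (e.factorial : ℝ) * (σ : ℝ) ^ ((F.a * dd) * (n - m)) <
        1 * (σ : ℝ) ^ (F.a * n * e) := by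
      rw [one_mul]
      calc c * κ ^ (n - m) * (e.factorial : ℝ) * (σ : ℝ) ^ ((F.a * dd) * (n - m))
          ≤ (c * κ ^ n * n.factorial) * (σ : ℝ) ^ ((F.a * dd) * (n - m)) :=
            mul_le_mul_of_nonneg_right hKle (by positivity)
        _ < (σ : ℝ) ^ (F.a * n * e) := Family.const_mul_pow_lt_pow hK0 hexp hσK hσ
    have := reshape one_pos hmain
    rw [mul_one] at this
    exact this.trans_le (mul_le_mul_of_nonneg_right hchoose (pow_nonneg hDpos.le _))

/-- **The zero-estimate numerics of the torsion case** (all orders `e`): for `σ` and the spacing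
`sp` beyond `c·κ₃^n·n!` (`κ₃ = n·2(4n)^{dd}·P₀`) and `a ≥ 1`:
`c·D^n < binom(T″+e,e)·sp·D^m` whenever `dd(n-m) ≤ en`, and `c·D^n < binom(T″+e,e)·D^m` when the
index inequality is strict. [cite: BakerWustholz2007, §6.8 (p. 119: "ℓS'T^d ≫ D^n")] -/
theorem numerics (hn : 1 ≤ n) (hdd : dd < n) {c : ℝ} (hc : 0 < c) (ha : 1 ≤ F.a)
    (hspc : c * ((n * (2 * (4 * n) ^ dd * F.P₀) : ℕ) : ℝ) ^ n * n.factorial < F.sp) {σ : ℕ} (hσ : 1 ≤ σ)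
    (hσK : c * ((n * (2 * (4 * n) ^ dd * F.P₀) : ℕ) : ℝ) ^ n * n.factorial < σ) (e m : ℕ) (hm : m < n)
    (hidx : dd * (n - m) ≤ e * n) :
    (c * ((n * F.D' n dd σ : ℕ) : ℝ) ^ n <
        (Nat.choose (F.T₂ n σ + e) e : ℝ) * (F.sp : ℝ) * ((n * F.D' n dd σ : ℕ) : ℝ) ^ m) ∧
    (dd * (n - m) < e * n →
      c * ((n * F.D' n dd σ : ℕ) : ℝ) ^ n < (Nat.choose (F.T₂ n σ + e) e : ℝ) * ((n * F.D' n dd σ : ℕ) : ℝ) ^ m) := by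
  by_cases hen : e ≤ n
  · exact F.numerics_le n dd hn hc ha hspc hσ hσK hen hm hidx
  · -- reduce to `e = n` by monotonicity of `choose`
    have hne : n ≤ e := by omega
    have hidx' : dd * (n - m) ≤ n * n := by nlinarith [Nat.sub_le n m, hdd.le]
    have hstr' : dd * (n - m) < n * n := by
      have : dd * (n - m) ≤ dd * n := Nat.mul_le_mul_left _ (Nat.sub_le _ _)
      have : dd * n < n * n := Nat.mul_lt_mul_of_lt_of_le hdd le_rfl (by omega)
      omega
    obtain ⟨hA, hB⟩ := F.numerics_le n dd hn hc ha hspc hσ hσK le_rfl hm hidx'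
    have hch : (Nat.choose (F.T₂ n σ + n) n : ℝ) ≤ (Nat.choose (F.T₂ n σ + e) e : ℝ) := by
      exact_mod_cast choose_add_mono _ hne
    have hDm : (0 : ℝ) ≤ ((n * F.D' n dd σ : ℕ) : ℝ) ^ m := by positivity
    have hS0 : (0 : ℝ) ≤ (F.sp : ℝ) := by positivity
    constructor
    · exact hA.trans_le (mul_le_mul_of_nonneg_right (mul_le_mul_of_nonneg_right hch hS0) hDm)
    · intro _
      exact (hB hstr').trans_le (mul_le_mul_of_nonneg_right hch hDm)

end TFamily

end BakerData

end Std

end GaGmE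

end Literature.NumberTheory.Transcendental

end
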